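import Literature.MathematicalPhysics.QuantumFieldTheory.Balaban1983to89.B13Lemma3Window

/-!
# `Balaban1983to89.B13Lemma3WindowTerms` — T. Bałaban, *Renormalization group approach to lattice gauge field theories.
II. Cluster expansions*, Commun. Math. Phys. **116** (1988) 1–22 [Balaban1988RG2Cluster]: the resummation pp. 17–20
proving Lemma 3, FROM (2.26) FOR EVERY TERM — the printed term set (𝐃, P) of the activity H(Z) INJECTED into the
majorant of `B13Lemma3Window.bound238With_window` on the two-scale window model, so that (2.38) AS PRINTED follows from
the per-term bound (2.26) and the restrictions on the constants alone (`bound238_window_of_226`)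

statement-level skeleton of published theorems with citation tags; proofs where landed; nothing here is a claim about the Yang–Mills mass gap

PDF held: `paper:balaban1988-cmp116-rg-ii-cluster` (journal page = PDF page + 0); pp. 12–20 re-read this session from
the text layer `p0012.txt`–`p0020.txt` of that key; the sentences used are quoted verbatim in the docstrings below.

CITATION HEADER / WHAT IS REPRODUCED (unit `lit-balaban-r10` gen 6, B13 fold owner; SKELETON rows `B13.Eq2.26`,
`B13.Eq2.35`, `B13.Eq2.37`, `B13.Eq2.38`, `B13.Lem3` of `HOME/lit-balaban-r10/ROWS-B13.md`, HOME =
`run/shared/lean/pub/lit-balaban/`; kind «model-instance»).  `B13Lemma3Assembly.bound238With_of_226` (gen 5) and its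
window instance `B13Lemma3Window.bound238_window` (gen 6) take the analytic input (2.26) in RESUMMED form: the
hypothesis `hrep` bounds ‖H(Z)‖ by the (2.26)-weights summed over the nested index sets of the majorant (Z′₀; components
Z′_i of Z′₀; families of 𝐃_{k+1}-domains covering Z′_i; non-empty sets of 𝐃_k-domains with a fixed closure; Y₀, P, 𝐃
per component).  Print states (2.26) PER TERM (𝐃, P) of (2.9)/(2.14) and then resums (p. 17, verbatim): *"To get a
bound for H(Z) we have to perform the resummation of the terms (2.14) over 𝐃, P and Z₀. We do it in the following
order. For a fixed Y₀ we sum over all 𝐃 satisfying (2.2). Next, we sum over Y₀, P determining a fixed Z₀. Further, for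
a fixed Z′₀, we sum over all possible Z₀ determining this fixed Z′₀. Finally we sum over all Z′₀ ⊂ Z."*  HERE that
passage is PROVED for the window model as the statement `sum_weight_le_majorant`: the sum of the (2.26)-weights over
ALL terms (𝐃, P) of H(Z) is bounded by the majorant — by realizing the term ↦ (Z′₀; Z′_i; families; component sets;
(Y₀ ∩ Z_i, P ∩ Z_i, 𝐃_i)) map as an INJECTION with multiplicative weights (pp. 17–18, verbatim: *"The sum over 𝐃
factorizes into independent sums over 𝐃_i, similarly the product over Y∈𝐃 in (2.26) factorizes into products over
Y∈𝐃_i"*; p. 19: *"A sum over n components is estimated by a product of n sums, each of them is a sum over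
independently changing components"*), through one generic injection-into-a-product bound and fiberwise sums at the
three printed levels (`sum_terms_le`: terms ↦ sets of components of Z₀; `step2`: per component of Z′₀, sets ↦ families
of closures ↦ parts with a fixed closure; `step1`: per Z′₀, sets ↦ their parts along the components of Z′₀;
`sum_admA_le`: grouping by Z′₀).  OBJECTS: `IsTerm`/`terms` (the terms: 𝐃 ⊂ 𝐃_k, P ⊂ bonds not inside Y₀ with cubes
in the window, Z₀ := Y₀ ∪ {endpoint cubes of P} ≠ ∅ — the cell's reading of p. 12/p. 18 under which *"one bond in P
may connect two cubes in Z₀∖Y₀"*, transcript G7 — and Z′₀ = `closureIdx L (collar Z₀)` ⊆ Z, p. 14 *"The sums are over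
Z such, that each connected component of Z contains a component of Z′₀"*), `weight` (the right side of (2.26) without
exp O(1)α₅|Z|), `compsD`/`restr` (components of Z₀ and the restriction of a term to one of them), `innerIdx`/`omega`/
`inner` (`B13Lemma3Assembly.innerSum` as one finite sum, `innerSum_eq`).  THEOREMS: `restr_mem_innerIdx`, `weight_factor`,
`eq_of_restr_eq`, `sum_terms_le`, `step2`, `step1`, `sum_admA_le`, **`sum_weight_le_majorant`**, **`hrep_of_termwise`**
((2.26) per term + termwise domination ⇒ `hrep`), **`bound238_window_of_226`** (d = 4, L = `c.L` ≥ 8: (2.38) AS PRINTED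
`B13.Bound238 W.toStepData c` from (2.26) per term and the restrictions on the constants).  No `sorry`, no new named
fact (D-0026); Mathlib + `B13Lemma3Window` only.

HONEST SCOPE.  (i) What stays by assertion is exactly the ANALYTIC content of the printed proof: the representation of
H(Z) by its terms ((2.9)/(2.14), hypothesis `hH`, stated as domination ‖H(Z)‖ ≤ Σ_t ‖T_t‖) and the per-term bound
(2.26) ← (2.15)–(2.25) (hypothesis `h226`).  (ii) The term set over-counts print's (tree-gauge bonds b₀(c) not excluded;
"not inside Y₀" read on endpoint cubes; window = free-boundary subset of ℤ^d, cell DIVERGENCE pv11/pv22) — harmless: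
extra terms may carry T_t = 0.  (iii) Z₀ := Y₀ ∪ {endpoint cubes of P} is the cell's reading (transcript G7, as in
`B13Lemma3Assembly`'s `htouch` ≤ 2 and `B13MayerDecoupling.card_le_two_mul_card_of_cover`); with p. 12's "interior"
sentence read literally (all closed cubes meeting a bond), bonds lying in walls would enlarge Z₀ and the printed G7
constant ½ — not followed.  (iv) The weight's first factor counts the LM-cubes of Z∖Z′₀ for THIS Z′₀; constants as in
`B13Lemma3Window` (HONEST SCOPE there).  Value = kernel-checked bookkeeping: the window-model Lemma 3 now rests on
(2.26) per term and numbers only.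
-/

namespace Literature.MathematicalPhysics.QuantumFieldTheory.Balaban1983to89.B13Lemma3WindowTerms

open Literature.MathematicalPhysics.QuantumFieldTheory.Balaban1983to89
open Literature.MathematicalPhysics.QuantumFieldTheory.Balaban1983to89.B13ScaleTransfer
  (Pt Adj FaceConnected block mem_block collar subset_collar coarse coarse_eq_iff closureIdx coarse_update_add_one)
open Literature.MathematicalPhysics.QuantumFieldTheory.Balaban1983to89.TreeLength (treeLen treeLen_nonneg)
open Literature.MathematicalPhysics.QuantumFieldTheory.Balaban1983to89.TreeLengthCubeSystem
  (IsDom Dom sys Cell cellsOf mem_cellsOf card_cellsOf cellsOf_inj cubeSys ineq227_cells)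
open Literature.MathematicalPhysics.QuantumFieldTheory.Balaban1983to89.B13Geometry236 (closureDom closureDom_val)
open Literature.MathematicalPhysics.QuantumFieldTheory.Balaban1983to89.B12TreeDecay (kappa₀ K₀)
open Literature.MathematicalPhysics.QuantumFieldTheory.Balaban1983to89.B13Eq210Components
  (compF compsF mem_compF mem_compsF compF_subset mem_compF_self isDom_compF biUnion_compsF compsF_pairwise
    adj_iff_wallAdjacent)
open Literature.MathematicalPhysics.QuantumFieldTheory.Balaban1983to89.B13Lemma3Assembly (innerSum compSum famSum admP)
open Literature.MathematicalPhysics.QuantumFieldTheory.Balaban1983to89.B13Lemma3Window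
  (LBond bondEnd touch avail mem_avail J I cc wZ dI isDom_I)
open Literature.MathematicalPhysics.QuantumFieldTheory.Balaban1983to89.B14Components (WConn)

noncomputable section

variable {d : ℕ}

/-! ## §1. A generic injection-into-a-product bound -/

/-- A generic INJECTION-INTO-A-PRODUCT bound (the combinatorial shape of every resummation step of pp. 17–20: *"A sum
over n components is estimated by a product of n sums, each of them is a sum over independently changing
components"*, p. 19): if every `a ∈ S` is determined by its coordinates `φ a i ∈ T i` (i ∈ s) and its weight is at
most the product of the coordinate weights (all ≥ 0), then `Σ_{a∈S} w a ≤ Π_{i∈s} Σ_{b∈T i} h i b` (`Finset.prod_sum`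
+ a sum over the image of an injection); private plumbing. [folklore] -/
private theorem sum_le_prod_sum {α ι β : Type*} (S : Finset α) (s : Finset ι) (T : ι → Finset β)
    (h : ι → β → ℝ) (hh : ∀ i ∈ s, ∀ b ∈ T i, 0 ≤ h i b) (φ : α → ι → β)
    (hφ : ∀ a ∈ S, ∀ i ∈ s, φ a i ∈ T i)
    (hinj : ∀ a ∈ S, ∀ a' ∈ S, (∀ i ∈ s, φ a i = φ a' i) → a = a')
    (w : α → ℝ) (hw : ∀ a ∈ S, w a ≤ ∏ i ∈ s, h i (φ a i)) :
    ∑ a ∈ S, w a ≤ ∏ i ∈ s, ∑ b ∈ T i, h i b := by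
  classical
  rw [Finset.prod_sum]
  set ψ : α → ((i : ι) → i ∈ s → β) := fun a i _ => φ a i with hψ
  have hψinj : ∀ a ∈ S, ∀ a' ∈ S, ψ a = ψ a' → a = a' := by
    intro a ha a' ha' heq
    refine hinj a ha a' ha' fun i hi => ?_
    have := congrFun (congrFun heq i) hi
    simpa [hψ] using this
  calc ∑ a ∈ S, w a ≤ ∑ a ∈ S, ∏ i ∈ s, h i (φ a i) := Finset.sum_le_sum hw
    _ = ∑ a ∈ S, ∏ x ∈ s.attach, h x.1 (ψ a x.1 x.2) := by
        refine Finset.sum_congr rfl fun a _ => ?_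
        exact (Finset.prod_attach s (fun i => h i (φ a i))).symm
    _ = ∑ p ∈ S.image ψ, ∏ x ∈ s.attach, h x.1 (p x.1 x.2) := by
        rw [Finset.sum_image hψinj]
    _ ≤ ∑ p ∈ s.pi T, ∏ x ∈ s.attach, h x.1 (p x.1 x.2) := by
        refine Finset.sum_le_sum_of_subset_of_nonneg ?_ fun p hp _ => ?_
        · intro p hp
          obtain ⟨a, ha, rfl⟩ := Finset.mem_image.1 hp
          exact Finset.mem_pi.2 fun i hi => hφ a ha i hi
        · exact Finset.prod_nonneg fun x _ => hh x.1 x.2 _ ((Finset.mem_pi.1 hp) x.1 x.2)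

/-! ## §2. Components: small complements -/

/-- Components are classes: the component of a member of the component of `a` is the component of `a`; private
plumbing. [folklore] -/
private theorem compF_eq_of_mem {Z : Finset (Pt d)} {a x : Pt d} (hx : x ∈ compF Z a) : compF Z x = compF Z a := by
  obtain ⟨hxZ, hax⟩ := mem_compF.1 hx
  ext b
  simp only [mem_compF]
  constructor
  · rintro ⟨hb, hxb⟩; exact ⟨hb, hax.trans hxb⟩
  · rintro ⟨hb, hab⟩; exact ⟨hb, (WConn.symm hax).trans hab⟩

/-- A component is closed under wall-adjacency inside `Z`; private plumbing. [folklore] -/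
private theorem mem_compF_of_adj {Z : Finset (Pt d)} {a x y : Pt d} (hx : x ∈ compF Z a) (hy : y ∈ Z) (hxy : Adj x y) :
    y ∈ compF Z a := by
  obtain ⟨hxZ, hax⟩ := mem_compF.1 hx
  exact mem_compF.2 ⟨hy, hax.tail ⟨Finset.mem_coe.2 hxZ, Finset.mem_coe.2 hy, adj_iff_wallAdjacent.1 hxy⟩⟩

/-- A connected family inside `Z` meeting a component lies inside it
(`B13Lemma3AssemblyWindow.subset_compF_of_faceConnected`); private plumbing. [folklore] -/
private theorem subset_compF_of_mem {Y Z : Finset (Pt d)} (hYc : FaceConnected Y) (hYZ : Y ⊆ Z) {x a : Pt d} (hx : x ∈ Y)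
    (hxa : x ∈ compF Z a) : Y ⊆ compF Z a := by
  rw [← compF_eq_of_mem hxa]
  exact B13Lemma3AssemblyWindow.subset_compF_of_faceConnected hYc hYZ hx

/-- Distinct components are disjoint (`B13Eq210Components.compsF_pairwise`); private plumbing. [folklore] -/
private theorem disjoint_of_mem_compsF {Z K K' : Finset (Pt d)} (hK : K ∈ compsF Z) (hK' : K' ∈ compsF Z) (hne : K ≠ K') :
    Disjoint K K' := by
  have hsep := compsF_pairwise Z (Finset.mem_coe.2 hK) (Finset.mem_coe.2 hK') hne
  exact Finset.disjoint_left.2 fun x hx hx' => (hsep x (Finset.mem_coe.2 hx) x (Finset.mem_coe.2 hx')).1 rfl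

/-- Two components sharing a cube are equal; private plumbing. [folklore] -/
private theorem eq_of_mem_compsF_of_mem {Z K K' : Finset (Pt d)} (hK : K ∈ compsF Z) (hK' : K' ∈ compsF Z) {x : Pt d}
    (hx : x ∈ K) (hx' : x ∈ K') : K = K' := by
  by_contra hne
  exact Finset.disjoint_left.1 (disjoint_of_mem_compsF hK hK' hne) hx hx'

/-- The component of a cube of `Z` is one of the components of `Z`; private plumbing. [folklore] -/
private theorem compF_mem_compsF {Z : Finset (Pt d)} {x : Pt d} (hx : x ∈ Z) : compF Z x ∈ compsF Z :=
  mem_compsF.2 ⟨x, hx, rfl⟩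

/-! ## §3. The closure Z ↦ Z′ distributes over unions -/

/-- X̃ of a union is the union of the X̃ (`collar` is a `biUnion` of the blocks □̃); private plumbing. [folklore] -/
private theorem collar_biUnion {ι : Type*} [DecidableEq ι] (F : Finset ι) (g : ι → Finset (Pt d)) :
    collar (F.biUnion g) = F.biUnion fun i => collar (g i) := by
  classical
  unfold collar
  exact Finset.biUnion_biUnion F g B13ScaleTransfer.block

/-- The family of LM-cubes met by a union is the union of the families; private plumbing. [folklore] -/
private theorem closureIdx_biUnion {ι : Type*} [DecidableEq ι] (L : ℕ) (F : Finset ι) (g : ι → Finset (Pt d)) :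
    closureIdx L (F.biUnion g) = F.biUnion fun i => closureIdx L (g i) := by
  classical
  unfold closureIdx
  exact Finset.biUnion_image

/-- Z′₀ is the union of the closures Z′_i of the components Z_i of Z₀ — p. 13 *"Z′₀ is a union of the smallest family
of such cubes containing Z̃₀"* with p. 19 *"Z₀ = ∪_i Z_i, and we denote by Z′_i the smallest localization domain from
𝐃_{k+1} containing Z̃_i"* (`B13Eq210Components.biUnion_compsF` + distributivity of X ↦ X̃ ↦ X′ over unions). [cite:
Balaban1988RG2Cluster, p.13 and p.19 (Z′₀ and the Z′_i)] -/
theorem closure_eq_biUnion_compsF (L : ℕ) (Z : Finset (Pt d)) :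
    closureIdx L (collar Z) = (compsF Z).biUnion fun K => closureIdx L (collar K) := by
  classical
  conv_lhs => rw [← biUnion_compsF Z]
  rw [show ((compsF Z).biUnion id) = (compsF Z).biUnion (fun K => K) from rfl, collar_biUnion, closureIdx_biUnion]


/-! ## §4. The terms (𝐃, P) of H(Z) on the window model and their data -/

/-- The M-cubes of the two endpoints of a bond ⟨y, y + e_μ⟩ of T₁^{(k)} (as index points; the M-cube of a site y is
`coarse M y`) — p. 18: *"one bond in P may connect two cubes in Z₀∖Y₀"*; `B13Lemma3Window.touch M Bk b` = these cubes
as cubes of the window (`touch_eq`). [cite: Balaban1988RG2Cluster, p.18 (before (2.31))] -/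
def bcubes (M : ℕ) (b : LBond d) : Finset (Pt d) := {coarse M b.1, coarse M (bondEnd b)}

/-- `B13Lemma3Window.touch` is `cellsOf` of the endpoint cubes; private plumbing. [folklore] -/
private theorem touch_eq (M : ℕ) (Bk : Finset (Pt d)) (b : LBond d) : touch M Bk b = cellsOf Bk (bcubes M b) := rfl

/-- The initial cube is one of the two cubes; private plumbing. [folklore] -/
private theorem fst_mem_bcubes (M : ℕ) (b : LBond d) : coarse M b.1 ∈ bcubes M b := Finset.mem_insert_self _ _

/-- The end cube is one of the two cubes; private plumbing. [folklore] -/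
private theorem end_mem_bcubes (M : ℕ) (b : LBond d) : coarse M (bondEnd b) ∈ bcubes M b :=
  Finset.mem_insert_of_mem (Finset.mem_singleton_self _)

/-- The two cubes of a bond coincide or have a common wall (`B13ScaleTransfer.coarse_update_add_one`; =
`B14Components.bond_cubes`, *"bonds never cross a corner"*); private plumbing. [folklore] -/
private theorem bcubes_cases {M : ℕ} (hM : 0 < M) (b : LBond d) :
    coarse M (bondEnd b) = coarse M b.1 ∨ Adj (coarse M b.1) (coarse M (bondEnd b)) := by
  rcases coarse_update_add_one hM b.1 b.2 with h | h
  · left; rw [bondEnd, h]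
  · right; rw [bondEnd, h]; exact B13ScaleTransfer.adj_update_add_one _ _

/-- Membership in the two-cube set; private plumbing. [folklore] -/
private theorem mem_bcubes_iff {M : ℕ} {b : LBond d} {x : Pt d} :
    x ∈ bcubes M b ↔ x = coarse M b.1 ∨ x = coarse M (bondEnd b) := by
  simp [bcubes]

/-- The M-cubes met by the bonds of P (endpoint cubes): Z₀∖Y₀ ⊆ these — p. 12 *"For a given set P we take the
smallest localization domain Z₀ ∈ 𝐃_k containing Y₀ and P"*, in the cell's reading of p. 18 (a bond meets the ≤ 2
cubes of its endpoints, transcript G7, `B13MayerDecoupling.card_le_two_mul_card_of_cover`). [cite: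
Balaban1988RG2Cluster, p.12 (before (2.4)) and p.18 (before (2.31))] -/
def cubesP (M : ℕ) (P : Finset (LBond d)) : Finset (Pt d) := P.biUnion (bcubes M)

/-- (2.2) p. 12, verbatim: *"Each term in the sum over subfamilies 𝐃 has the underintegral expression localized in
the domain Y₀ = ∪_{Y∈𝐃} Y"* — as a family of M-cube indices. [cite: Balaban1988RG2Cluster, (2.2) p.12] -/
def Y0 {Bk : Finset (Pt d)} (D : Finset (Dom Bk)) : Finset (Pt d) := D.biUnion fun Y => Y.1

/-- Z₀ of a term (𝐃, P): p. 12 *"the smallest localization domain Z₀ ∈ 𝐃_k containing Y₀ and P"*, p. 18 *"In general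
the set Z₀ is a union of connected components"* — in the cell's reading Z₀ = Y₀ ∪ {endpoint cubes of the bonds of P}
(transcript G7; the reading under which p. 18's *"one bond in P may connect two cubes in Z₀∖Y₀"* holds; p. 12's
*"bonds of P have to be contained in the interior of Z₀"* would adjoin further cubes for bonds lying in walls — not
followed, exactly as in `B13Lemma3Assembly` (`htouch` ≤ 2)). [cite: Balaban1988RG2Cluster, p.12 (before (2.4)) and
p.18 (before (2.31))] -/
def Z0 (M : ℕ) {Bk : Finset (Pt d)} (t : Finset (Dom Bk) × Finset (LBond d)) : Finset (Pt d) :=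
  Y0 t.1 ∪ cubesP M t.2

/-- The TERMS (𝐃, P) of the activity H(Z), Z ∈ 𝐃_{k+1} (pp. 12–14): 𝐃 ⊂ 𝐃_k a subfamily ((2.1)), P a set of bonds
with cubes in the scale-k window and not inside Y₀ ((2.3): *"Y₀ᶜ = {b ∈ T₁^{(k)} : b ⊄ Y₀} ∖ {b₀(c) : c ∈
T^{(k+1)}}"*; a bond with both endpoint cubes in Y₀ lies inside Y₀; the tree-gauge bonds b₀(c) are not excluded —
over-count), Z₀ ≠ ∅, and Z′₀ ⊆ Z ((2.9) p. 14: *"H(Z) = Σ_{Z₀ : Z′₀ ⊂ Z} H(Z, Z₀)"*, *"The sums are over Z such, that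
each connected component of Z contains a component of Z′₀"* — for connected Z: Z′₀ ⊆ Z, Z′₀ ≠ ∅).  The printed term
set injects into this one (over-counting only enlarges the majorant and weakens the hypotheses below). [cite:
Balaban1988RG2Cluster, (2.1)–(2.3) p.12 and (2.9) p.14] -/
def IsTerm (L M : ℕ) {Bk Bk1 : Finset (Pt d)} (Z : Dom Bk1) (t : Finset (Dom Bk) × Finset (LBond d)) : Prop :=
  cubesP M t.2 ⊆ Bk ∧ (∀ b ∈ t.2, ¬ bcubes M b ⊆ Y0 t.1) ∧ (Z0 M t).Nonempty ∧
    closureIdx L (collar (Z0 M t)) ⊆ Z.1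

/-- A finite universe for the bond sets P: the bonds whose initial site lies in an M-cube of the window; plumbing.
[folklore] -/
def allBonds (M : ℕ) (Bk : Finset (Pt d)) : Finset (LBond d) :=
  (Bk.biUnion fun x => Fintype.piFinset fun i => Finset.Ico ((M : ℤ) * x i) ((M : ℤ) * x i + M)) ×ˢ Finset.univ

/-- A bond whose initial cube is in the window is in the universe; private plumbing. [folklore] -/
private theorem mem_allBonds {M : ℕ} (hM : 0 < M) {Bk : Finset (Pt d)} {b : LBond d} (h : coarse M b.1 ∈ Bk) :
    b ∈ allBonds M Bk := by
  refine Finset.mem_product.2 ⟨Finset.mem_biUnion.2 ⟨coarse M b.1, h, ?_⟩, Finset.mem_univ _⟩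
  have hc := (coarse_eq_iff hM b.1 (coarse M b.1)).1 rfl
  simp only [Fintype.mem_piFinset, Finset.mem_Ico]
  intro i
  obtain ⟨h1, h2⟩ := hc i
  exact ⟨h1, by linarith⟩

open Classical in
/-- The finite set of terms (𝐃, P) of H(Z) (`IsTerm`), the index set of *"the sums in (2.9), (2.1), (2.3) over Z₀, 𝐃,
P"* (p. 14) for the window model. [cite: Balaban1988RG2Cluster, (2.9) p.14 and (2.14) p.15] -/
def terms (L M : ℕ) (Bk : Finset (Pt d)) {Bk1 : Finset (Pt d)} (Z : Dom Bk1) :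
    Finset (Finset (Dom Bk) × Finset (LBond d)) :=
  ((Finset.univ : Finset (Dom Bk)).powerset ×ˢ (allBonds M Bk).powerset).filter (IsTerm L M Z)

/-- Membership in `terms` is `IsTerm` (the universe constraint is automatic). [cite: Balaban1988RG2Cluster, (2.9)
p.14 and (2.14) p.15] -/
theorem mem_terms {L M : ℕ} (hM : 0 < M) {Bk Bk1 : Finset (Pt d)} {Z : Dom Bk1}
    {t : Finset (Dom Bk) × Finset (LBond d)} : t ∈ terms L M Bk Z ↔ IsTerm L M Z t := by
  classical
  unfold terms
  rw [Finset.mem_filter, Finset.mem_product, Finset.mem_powerset, Finset.mem_powerset]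
  constructor
  · exact fun h => h.2
  · intro h
    refine ⟨⟨Finset.subset_univ _, fun b hb => mem_allBonds hM (h.1 ?_)⟩, h⟩
    exact Finset.mem_biUnion.2 ⟨b, hb, fst_mem_bcubes M b⟩

/-- A member of `terms` is a term; private plumbing. [folklore] -/
private theorem isTerm_of_mem_terms {L M : ℕ} {Bk Bk1 : Finset (Pt d)} {Z : Dom Bk1}
    {t : Finset (Dom Bk) × Finset (LBond d)} (ht : t ∈ terms L M Bk Z) : IsTerm L M Z t := by
  classical
  exact (Finset.mem_filter.1 ht).2

/-- Y₀ lies in the scale-k window; private plumbing. [folklore] -/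
private theorem Y0_subset {Bk : Finset (Pt d)} (D : Finset (Dom Bk)) : Y0 D ⊆ Bk := by
  intro x hx
  obtain ⟨Y, _, hxY⟩ := Finset.mem_biUnion.1 hx
  exact Y.2.1 hxY

/-- Z₀ of a term lies in the scale-k window; private plumbing. [folklore] -/
private theorem Z0_subset {L M : ℕ} {Bk Bk1 : Finset (Pt d)} {Z : Dom Bk1} {t : Finset (Dom Bk) × Finset (LBond d)}
    (ht : IsTerm L M Z t) : Z0 M t ⊆ Bk :=
  Finset.union_subset (Y0_subset t.1) ht.1

/-- The cubes of a bond of P are cubes of Z₀; private plumbing. [folklore] -/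
private theorem bcubes_subset_Z0 (M : ℕ) {Bk : Finset (Pt d)} {t : Finset (Dom Bk) × Finset (LBond d)} {b : LBond d}
    (hb : b ∈ t.2) : bcubes M b ⊆ Z0 M t :=
  fun _ hx => Finset.mem_union_right _ (Finset.mem_biUnion.2 ⟨b, hb, hx⟩)

/-- A member of 𝐃 lies in Z₀; private plumbing. [folklore] -/
private theorem val_subset_Z0 (M : ℕ) {Bk : Finset (Pt d)} {t : Finset (Dom Bk) × Finset (LBond d)} {Y : Dom Bk}
    (hY : Y ∈ t.1) : Y.1 ⊆ Z0 M t :=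
  fun _ hx => Finset.mem_union_left _ (Finset.mem_biUnion.2 ⟨Y, hY, hx⟩)

/-! ### The components of Z₀ as scale-k domains, and the restriction of a term to a component -/

open Classical in
/-- The connected components Z_i of Z₀ as 𝐃_k-domains of the window — p. 18/19, verbatim: *"In general the set Z₀ is
a union of connected components. Let us denote one of the components by Z₀."* / *"The set Z₀ is a union of connected
components, Z₀ = ∪_i Z_i"* (`B13Eq210Components.compsF`). [cite: Balaban1988RG2Cluster, p.18 (before (2.32)) and
(2.35) p.19] -/
def compsD (M : ℕ) (Bk : Finset (Pt d)) (t : Finset (Dom Bk) × Finset (LBond d)) : Finset (Dom Bk) :=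
  Finset.univ.filter fun Zc : Dom Bk => Zc.1 ∈ compsF (Z0 M t)

/-- Membership in `compsD`; private plumbing. [folklore] -/
private theorem mem_compsD {M : ℕ} {Bk : Finset (Pt d)} {t : Finset (Dom Bk) × Finset (LBond d)} {Zc : Dom Bk} :
    Zc ∈ compsD M Bk t ↔ Zc.1 ∈ compsF (Z0 M t) := by
  classical
  simp [compsD]

/-- The component of a cube of Z₀ of a term, as a 𝐃_k-domain of the window (`B13Eq210Components.isDom_compF`);
plumbing. [folklore] -/
def compAt {L M : ℕ} {Bk Bk1 : Finset (Pt d)} {Z : Dom Bk1} {t : Finset (Dom Bk) × Finset (LBond d)}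
    (ht : IsTerm L M Z t) {x : Pt d} (hx : x ∈ Z0 M t) : Dom Bk :=
  ⟨compF (Z0 M t) x, isDom_compF (Z0_subset ht) hx⟩

/-- It is one of the components; private plumbing. [folklore] -/
private theorem compAt_mem {L M : ℕ} {Bk Bk1 : Finset (Pt d)} {Z : Dom Bk1} {t : Finset (Dom Bk) × Finset (LBond d)}
    (ht : IsTerm L M Z t) {x : Pt d} (hx : x ∈ Z0 M t) : compAt ht hx ∈ compsD M Bk t :=
  mem_compsD.2 (compF_mem_compsF hx)

/-- It contains the cube; private plumbing. [folklore] -/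
private theorem mem_compAt {L M : ℕ} {Bk Bk1 : Finset (Pt d)} {Z : Dom Bk1} {t : Finset (Dom Bk) × Finset (LBond d)}
    (ht : IsTerm L M Z t) {x : Pt d} (hx : x ∈ Z0 M t) : x ∈ (compAt ht hx).1 :=
  mem_compF_self hx

/-- The part Y₀ ∩ Z_i of Y₀ in a component (p. 18: *"For simplicity let us denote by Y₀ one of the components"*; p.
18: the component Z₀ *"contains Y₀ = ∪_i Y_i"*), as cubes of the window. [cite: Balaban1988RG2Cluster, p.17–18
(decomposition of Y₀ and 𝐃)] -/
def rY {Bk : Finset (Pt d)} (t : Finset (Dom Bk) × Finset (LBond d)) (Zc : Dom Bk) : Finset (Cell Bk) :=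
  cellsOf Bk (Y0 t.1 ∩ Zc.1)

open Classical in
/-- The bonds of P in a component (those whose initial cube lies in it; both cubes then do, `bcubes_subset_comp`) —
the P-part of the restriction of a term to a component of Z₀ (p. 18: the |P|-factor of (2.26) is used component by
component in (2.31)–(2.33)). [cite: Balaban1988RG2Cluster, p.18 (the sum over Y₀, P with fixed Z₀)] -/
def rP (M : ℕ) {Bk : Finset (Pt d)} (t : Finset (Dom Bk) × Finset (LBond d)) (Zc : Dom Bk) : Finset (LBond d) :=
  t.2.filter fun b => coarse M b.1 ∈ Zc.1

open Classical in
/-- The members of 𝐃 inside a component — pp. 17–18, verbatim: *"this decomposition induces the decomposition of the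
families 𝐃, 𝐃 = ∪_i 𝐃_i, 𝐃_i satisfy ∪_{Y∈𝐃_i} Y = Y_i. The sum over 𝐃 factorizes into independent sums over 𝐃_i,
similarly the product over Y∈𝐃 in (2.26) factorizes into products over Y∈𝐃_i"*. [cite: Balaban1988RG2Cluster, p.17–18
(decomposition of 𝐃)] -/
def rD {Bk : Finset (Pt d)} (t : Finset (Dom Bk) × Finset (LBond d)) (Zc : Dom Bk) : Finset (Dom Bk) :=
  t.1.filter fun Y => Y.1 ⊆ Zc.1

/-- The index set of the per-component sum `B13Lemma3Assembly.innerSum` (over Y₀ ⊆ Z_i, admissible P, covering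
families 𝐃 of Y₀) as ONE finite set of triples (Y₀, P, 𝐃) (`innerSum_eq`). [cite: Balaban1988RG2Cluster, (2.26) p.17
and p.17 (resummation order)] -/
def innerIdx (M : ℕ) (Bk : Finset (Pt d)) (Zc : Dom Bk) :
    Finset (Σ _ : Finset (Cell Bk), Finset (LBond d) × Finset (Dom Bk)) :=
  (cellsOf Bk Zc.1).powerset.sigma fun Y₀ =>
    admP (cellsOf Bk Zc.1) (touch M Bk) (avail M Bk Zc Y₀) Y₀ ×ˢ
      B13FamilySum.coveringFamilies (Finset.univ : Finset (Dom Bk)) (fun Y : Dom Bk => cellsOf Bk Y.1) Y₀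

/-- The (2.26)-weight of one triple (Y₀, P, 𝐃) of a component: Π_{Y∈𝐃} α₆ε₂e^{−(1−3δ)κd_k(Y)} · e^{−(a/2)|P|} (α₆ε₂ =
2E₀ε₁C₁α₄⁻¹M^q exp C₂κ₁ by the definition of ε₂ p. 19; a = γ₂ε₁²/g_k²) — the summand of `innerSum`. [cite:
Balaban1988RG2Cluster, (2.26) p.17] -/
def omega (c : B13.Consts) (a : ℝ) {Bk : Finset (Pt d)}
    (x : Σ _ : Finset (Cell Bk), Finset (LBond d) × Finset (Dom Bk)) : ℝ :=
  (∏ Y ∈ x.2.2, (c.α₆ * c.eps2 * Real.exp (-((1 - 3 * c.δ) * c.κ * (sys Bk).dj Y)))) *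
    Real.exp (-(a / 2 * (x.2.1.card : ℝ)))

/-- The weights are non-negative; private plumbing. [folklore] -/
private theorem omega_nonneg (c : B13.Consts) (a : ℝ) (hA : 0 ≤ c.α₆ * c.eps2) {Bk : Finset (Pt d)}
    (x : Σ _ : Finset (Cell Bk), Finset (LBond d) × Finset (Dom Bk)) : 0 ≤ omega c a x :=
  mul_nonneg (Finset.prod_nonneg fun _ _ => mul_nonneg hA (Real.exp_nonneg _)) (Real.exp_nonneg _)

/-- `B13Lemma3Assembly.innerSum` on the window data IS the sum of `omega` over `innerIdx` (`Finset.sum_sigma`,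
`Finset.sum_product`). [cite: Balaban1988RG2Cluster, (2.26) p.17 and p.17 (resummation order)] -/
theorem innerSum_eq (c : B13.Consts) (a : ℝ) (M : ℕ) (Bk : Finset (Pt d)) (Zc : Dom Bk) :
    innerSum (Finset.univ : Finset (Dom Bk)) (fun Y : Dom Bk => cellsOf Bk Y.1) (sys Bk).dj (cellsOf Bk Zc.1)
      (touch M Bk) (avail M Bk Zc) (c.α₆ * c.eps2) ((1 - 3 * c.δ) * c.κ) a =
      ∑ x ∈ innerIdx M Bk Zc, omega c a x := by
  unfold innerSum innerIdx
  rw [Finset.sum_sigma]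
  refine Finset.sum_congr rfl fun Y₀ _ => ?_
  rw [Finset.sum_product]
  rfl

/-- The restriction of a term (𝐃, P) to a component Z_i of Z₀: (Y₀ ∩ Z_i, P ∩ bonds of Z_i, 𝐃_i) — the data summed
*"over Y₀, P determining a fixed Z₀"* for ONE component (pp. 17–18). [cite: Balaban1988RG2Cluster, p.17–18
(decomposition of Y₀ and 𝐃)] -/
def restr (M : ℕ) {Bk : Finset (Pt d)} (t : Finset (Dom Bk) × Finset (LBond d)) (Zc : Dom Bk) :
    Σ _ : Finset (Cell Bk), Finset (LBond d) × Finset (Dom Bk) :=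
  ⟨rY t Zc, (rP M t Zc, rD t Zc)⟩

/-! ### The restriction lands in the index set of `innerSum` -/

/-- Both cubes of a bond of P lie in the component of its initial cube (they coincide or share a wall); private
plumbing. [folklore] -/
private theorem bcubes_subset_comp {M : ℕ} (hM : 0 < M) {Bk : Finset (Pt d)}
    {t : Finset (Dom Bk) × Finset (LBond d)} {b : LBond d} (hb : b ∈ t.2) {Zc : Dom Bk}
    (hZc : Zc ∈ compsD M Bk t) (h1 : coarse M b.1 ∈ Zc.1) : bcubes M b ⊆ Zc.1 := by
  obtain ⟨a, -, haZ⟩ := mem_compsF.1 (mem_compsD.1 hZc)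
  intro x hx
  rcases mem_bcubes_iff.1 hx with rfl | rfl
  · exact h1
  · rw [← haZ] at h1 ⊢
    rcases bcubes_cases hM b with h | h
    · rw [h]; exact h1
    · exact mem_compF_of_adj h1 (bcubes_subset_Z0 M hb (end_mem_bcubes M b)) h

/-- A bond of P whose end cube lies in a component has its initial cube there; private plumbing. [folklore] -/
private theorem fst_mem_of_end_mem {M : ℕ} (hM : 0 < M) {Bk : Finset (Pt d)}
    {t : Finset (Dom Bk) × Finset (LBond d)} {b : LBond d} (hb : b ∈ t.2) {Zc : Dom Bk}
    (hZc : Zc ∈ compsD M Bk t) (h2 : coarse M (bondEnd b) ∈ Zc.1) : coarse M b.1 ∈ Zc.1 := by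
  obtain ⟨a, -, haZ⟩ := mem_compsF.1 (mem_compsD.1 hZc)
  rw [← haZ] at h2 ⊢
  rcases bcubes_cases hM b with h | h
  · rw [← h]; exact h2
  · exact mem_compF_of_adj h2 (bcubes_subset_Z0 M hb (fst_mem_bcubes M b)) h.symm

/-- A member of 𝐃 meeting a component lies inside it; private plumbing. [folklore] -/
private theorem val_subset_comp {M : ℕ} {Bk : Finset (Pt d)} {t : Finset (Dom Bk) × Finset (LBond d)} {Y : Dom Bk}
    (hY : Y ∈ t.1) {Zc : Dom Bk} (hZc : Zc ∈ compsD M Bk t) {x : Pt d} (hxY : x ∈ Y.1) (hxZ : x ∈ Zc.1) :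
    Y.1 ⊆ Zc.1 := by
  obtain ⟨a, -, haZ⟩ := mem_compsF.1 (mem_compsD.1 hZc)
  rw [← haZ] at hxZ ⊢
  exact subset_compF_of_mem Y.2.2.2 (val_subset_Z0 M hY) hxY hxZ

/-- **The restriction of a term to a component Z_i of Z₀ is one of the triples summed in `innerSum`**: Y₀ ∩ Z_i ⊆
Z_i; P ∩ bonds(Z_i) is ADMISSIBLE (`B13Lemma3Assembly.admP`: contained in the available bonds `B13Lemma3Window.avail`
— each lies in Z_i and not inside Y₀, `mem_avail` — and its cubes cover Z_i∖Y₀, p. 18 *"The definition of Z₀ yields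
|P| ≧ ½M⁻⁴|Z₀∖Y₀|"*); 𝐃_i covers exactly Y₀ ∩ Z_i (p. 17 *"𝐃_i satisfy ∪_{Y∈𝐃_i} Y = Y_i"*). [cite:
Balaban1988RG2Cluster, p.17–18 (decomposition of Y₀ and 𝐃) and p.18 (before (2.31))] -/
theorem restr_mem_innerIdx {L M : ℕ} (hM : 0 < M) {Bk Bk1 : Finset (Pt d)} {Z : Dom Bk1}
    {t : Finset (Dom Bk) × Finset (LBond d)} (ht : IsTerm L M Z t) {Zc : Dom Bk} (hZc : Zc ∈ compsD M Bk t) :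
    restr M t Zc ∈ innerIdx M Bk Zc := by
  classical
  unfold innerIdx restr
  rw [Finset.mem_sigma, Finset.mem_powerset, Finset.mem_product]
  refine ⟨fun q hq => mem_cellsOf.2 (Finset.mem_inter.1 (mem_cellsOf.1 hq)).2, ?_, ?_⟩
  · -- P ∩ (bonds of the component) is admissible
    unfold admP
    rw [Finset.mem_filter, Finset.mem_powerset]
    constructor
    · intro b hb
      obtain ⟨hbt, hb1⟩ := Finset.mem_filter.1 hb
      have hsub : bcubes M b ⊆ Zc.1 := bcubes_subset_comp hM hbt hZc hb1
      refine mem_avail hM Zc (rY t Zc) ?_ ?_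
      · intro q hq
        rw [touch_eq] at hq
        exact mem_cellsOf.2 (hsub (mem_cellsOf.1 hq))
      · intro hq
        apply ht.2.1 b hbt
        intro x hx
        have hxB : x ∈ Bk := ht.1 (Finset.mem_biUnion.2 ⟨b, hbt, hx⟩)
        have : (⟨x, hxB⟩ : Cell Bk) ∈ rY t Zc := hq (by rw [touch_eq]; exact mem_cellsOf.2 hx)
        exact (Finset.mem_inter.1 (mem_cellsOf.1 this)).1
    · intro q hq
      obtain ⟨hqZ, hqY⟩ := Finset.mem_sdiff.1 hq
      have hqZ' : q.1 ∈ Zc.1 := mem_cellsOf.1 hqZ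
      have hqZ0 : q.1 ∈ Z0 M t := by
        obtain ⟨a, -, haZ⟩ := mem_compsF.1 (mem_compsD.1 hZc)
        rw [← haZ] at hqZ'
        exact compF_subset _ _ hqZ'
      have hqnotY : q.1 ∉ Y0 t.1 := fun h => hqY (mem_cellsOf.2 (Finset.mem_inter.2 ⟨h, hqZ'⟩))
      rcases Finset.mem_union.1 hqZ0 with h | h
      · exact absurd h hqnotY
      · obtain ⟨b, hbt, hqb⟩ := Finset.mem_biUnion.1 h
        have hb1 : coarse M b.1 ∈ Zc.1 := by
          rcases mem_bcubes_iff.1 hqb with h' | h'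
          · rw [← h']; exact hqZ'
          · exact fst_mem_of_end_mem hM hbt hZc (h' ▸ hqZ')
        refine Finset.mem_biUnion.2 ⟨b, Finset.mem_filter.2 ⟨hbt, hb1⟩, ?_⟩
        rw [touch_eq]
        exact mem_cellsOf.2 hqb
  · -- 𝐃 ∩ (domains inside the component) covers Y₀ ∩ component
    rw [B13FamilySum.mem_coveringFamilies]
    refine ⟨Finset.subset_univ _, ?_⟩
    ext q
    rw [Finset.mem_biUnion]
    constructor
    · rintro ⟨Y, hY, hq⟩
      obtain ⟨hYt, hYZ⟩ := Finset.mem_filter.1 hY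
      exact mem_cellsOf.2 (Finset.mem_inter.2
        ⟨Finset.mem_biUnion.2 ⟨Y, hYt, mem_cellsOf.1 hq⟩, hYZ (mem_cellsOf.1 hq)⟩)
    · intro hq
      obtain ⟨hqY, hqZ⟩ := Finset.mem_inter.1 (mem_cellsOf.1 hq)
      obtain ⟨Y, hYt, hqY'⟩ := Finset.mem_biUnion.1 hqY
      exact ⟨Y, Finset.mem_filter.2 ⟨hYt, val_subset_comp hYt hZc hqY' hqZ⟩, mem_cellsOf.2 hqY'⟩


/-! ### Every member of 𝐃 and every bond of P belongs to exactly one component -/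

open Classical in
/-- 𝐃 = ∪_i 𝐃_i over the components (p. 17); private plumbing. [folklore] -/
private theorem fst_eq_biUnion_rD {L M : ℕ} {Bk Bk1 : Finset (Pt d)} {Z : Dom Bk1} {t : Finset (Dom Bk) × Finset (LBond d)}
    (ht : IsTerm L M Z t) : t.1 = (compsD M Bk t).biUnion (rD t) := by
  classical
  ext Y
  rw [Finset.mem_biUnion]
  constructor
  · intro hY
    obtain ⟨y, hy⟩ := Y.2.2.1
    have hyZ : y ∈ Z0 M t := val_subset_Z0 M hY hy
    refine ⟨compAt ht hyZ, compAt_mem ht hyZ, Finset.mem_filter.2 ⟨hY, ?_⟩⟩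
    exact val_subset_comp hY (compAt_mem ht hyZ) hy (mem_compAt ht hyZ)
  · rintro ⟨Zc, -, hY⟩
    exact (Finset.mem_filter.1 hY).1

/-- The 𝐃_i are pairwise disjoint; private plumbing. [folklore] -/
private theorem rD_disjoint {M : ℕ} {Bk : Finset (Pt d)} {t : Finset (Dom Bk) × Finset (LBond d)} {Zc Zc' : Dom Bk}
    (hZc : Zc ∈ compsD M Bk t) (hZc' : Zc' ∈ compsD M Bk t) (hne : Zc ≠ Zc') : Disjoint (rD t Zc) (rD t Zc') := by
  classical
  rw [Finset.disjoint_left]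
  intro Y hY hY'
  obtain ⟨-, h1⟩ := Finset.mem_filter.1 hY
  obtain ⟨-, h2⟩ := Finset.mem_filter.1 hY'
  obtain ⟨y, hy⟩ := Y.2.2.1
  exact hne (Subtype.ext (eq_of_mem_compsF_of_mem (mem_compsD.1 hZc) (mem_compsD.1 hZc') (h1 hy) (h2 hy)))

/-- P = ∪_i (P ∩ bonds of Z_i); private plumbing. [folklore] -/
private theorem snd_eq_biUnion_rP {L M : ℕ} {Bk Bk1 : Finset (Pt d)} {Z : Dom Bk1} {t : Finset (Dom Bk) × Finset (LBond d)}
    (ht : IsTerm L M Z t) : t.2 = (compsD M Bk t).biUnion (rP M t) := by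
  classical
  ext b
  rw [Finset.mem_biUnion]
  constructor
  · intro hb
    have h1 : coarse M b.1 ∈ Z0 M t := bcubes_subset_Z0 M hb (fst_mem_bcubes M b)
    exact ⟨compAt ht h1, compAt_mem ht h1, Finset.mem_filter.2 ⟨hb, mem_compAt ht h1⟩⟩
  · rintro ⟨Zc, -, hb⟩
    exact (Finset.mem_filter.1 hb).1

/-- The P-parts are pairwise disjoint; private plumbing. [folklore] -/
private theorem rP_disjoint {M : ℕ} {Bk : Finset (Pt d)} {t : Finset (Dom Bk) × Finset (LBond d)} {Zc Zc' : Dom Bk}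
    (hZc : Zc ∈ compsD M Bk t) (hZc' : Zc' ∈ compsD M Bk t) (hne : Zc ≠ Zc') :
    Disjoint (rP M t Zc) (rP M t Zc') := by
  classical
  rw [Finset.disjoint_left]
  intro b hb hb'
  obtain ⟨-, h1⟩ := Finset.mem_filter.1 hb
  obtain ⟨-, h2⟩ := Finset.mem_filter.1 hb'
  exact hne (Subtype.ext (eq_of_mem_compsF_of_mem (mem_compsD.1 hZc) (mem_compsD.1 hZc') h1 h2))

/-- **The (2.26)-weight of a term FACTORIZES over the components of Z₀** — pp. 17–18, verbatim: *"The sum over 𝐃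
factorizes into independent sums over 𝐃_i, similarly the product over Y∈𝐃 in (2.26) factorizes into products over
Y∈𝐃_i"*, and |P| = Σ_i |P ∩ bonds(Z_i)|: Π_{Y∈𝐃}(α₆ε₂e^{−(1−3δ)κd_k(Y)})·e^{−(a/2)|P|} = Π_{Z_i} omega(restriction to
Z_i). [cite: Balaban1988RG2Cluster, p.17–18 (factorization over components)] -/
theorem weight_factor {L M : ℕ} {Bk Bk1 : Finset (Pt d)} {Z : Dom Bk1} {t : Finset (Dom Bk) × Finset (LBond d)}
    (ht : IsTerm L M Z t) (c : B13.Consts) (a : ℝ) :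
    (∏ Y ∈ t.1, (c.α₆ * c.eps2 * Real.exp (-((1 - 3 * c.δ) * c.κ * (sys Bk).dj Y)))) *
        Real.exp (-(a / 2 * (t.2.card : ℝ))) =
      ∏ Zc ∈ compsD M Bk t, omega c a (restr M t Zc) := by
  classical
  have h1 : ∏ Y ∈ t.1, (c.α₆ * c.eps2 * Real.exp (-((1 - 3 * c.δ) * c.κ * (sys Bk).dj Y))) =
      ∏ Zc ∈ compsD M Bk t, ∏ Y ∈ rD t Zc, (c.α₆ * c.eps2 * Real.exp (-((1 - 3 * c.δ) * c.κ * (sys Bk).dj Y))) := by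
    conv_lhs => rw [fst_eq_biUnion_rD ht]
    exact Finset.prod_biUnion fun Zc hZc Zc' hZc' hne => rD_disjoint hZc hZc' hne
  have h2 : (t.2.card : ℝ) = ∑ Zc ∈ compsD M Bk t, ((rP M t Zc).card : ℝ) := by
    conv_lhs => rw [snd_eq_biUnion_rP ht]
    rw [Finset.card_biUnion fun Zc hZc Zc' hZc' hne => rP_disjoint hZc hZc' hne]
    push_cast
    rfl
  have h3 : Real.exp (-(a / 2 * (t.2.card : ℝ))) = ∏ Zc ∈ compsD M Bk t, Real.exp (-(a / 2 * ((rP M t Zc).card : ℝ))) := by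
    rw [h2, Finset.mul_sum, ← Finset.sum_neg_distrib, Real.exp_sum]
  rw [h1, h3, ← Finset.prod_mul_distrib]
  rfl

/-- 𝐃 is recovered from the 𝐃_i; private plumbing. [folklore] -/
private theorem fst_subset_of_rD {L M : ℕ} {Bk Bk1 : Finset (Pt d)} {Z : Dom Bk1} {t t' : Finset (Dom Bk) × Finset (LBond d)}
    (ht : IsTerm L M Z t) (h : ∀ Zc ∈ compsD M Bk t, rD t Zc = rD t' Zc) : t.1 ⊆ t'.1 := by
  classical
  intro Y hY
  obtain ⟨y, hy⟩ := Y.2.2.1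
  have hyZ : y ∈ Z0 M t := val_subset_Z0 M hY hy
  have hmem : Y ∈ rD t (compAt ht hyZ) :=
    Finset.mem_filter.2 ⟨hY, val_subset_comp hY (compAt_mem ht hyZ) hy (mem_compAt ht hyZ)⟩
  rw [h _ (compAt_mem ht hyZ)] at hmem
  exact (Finset.mem_filter.1 hmem).1

/-- P is recovered from its parts; private plumbing. [folklore] -/
private theorem snd_subset_of_rP {L M : ℕ} {Bk Bk1 : Finset (Pt d)} {Z : Dom Bk1} {t t' : Finset (Dom Bk) × Finset (LBond d)}
    (ht : IsTerm L M Z t) (h : ∀ Zc ∈ compsD M Bk t, rP M t Zc = rP M t' Zc) : t.2 ⊆ t'.2 := by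
  classical
  intro b hb
  have h1 : coarse M b.1 ∈ Z0 M t := bcubes_subset_Z0 M hb (fst_mem_bcubes M b)
  have hmem : b ∈ rP M t (compAt ht h1) := Finset.mem_filter.2 ⟨hb, mem_compAt ht h1⟩
  rw [h _ (compAt_mem ht h1)] at hmem
  exact (Finset.mem_filter.1 hmem).1

/-- Equality of restrictions componentwise; private plumbing. [folklore] -/
private theorem restr_eq_iff {M : ℕ} {Bk : Finset (Pt d)} {t t' : Finset (Dom Bk) × Finset (LBond d)} {Zc : Dom Bk} :
    restr M t Zc = restr M t' Zc ↔ rY t Zc = rY t' Zc ∧ rP M t Zc = rP M t' Zc ∧ rD t Zc = rD t' Zc := by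
  unfold restr
  rw [Sigma.mk.inj_iff, heq_iff_eq, Prod.mk.injEq]

/-- **A term is determined by its set of components and its restrictions to them** (the injectivity behind *"we sum
over Y₀, P determining a fixed Z₀"*, p. 17: different terms with the same Z₀ differ in some component). [cite:
Balaban1988RG2Cluster, p.17 (resummation order)] -/
theorem eq_of_restr_eq {L M : ℕ} {Bk Bk1 : Finset (Pt d)} {Z : Dom Bk1} {t t' : Finset (Dom Bk) × Finset (LBond d)}
    (ht : IsTerm L M Z t) (ht' : IsTerm L M Z t') (hA : compsD M Bk t = compsD M Bk t')
    (h : ∀ Zc ∈ compsD M Bk t, restr M t Zc = restr M t' Zc) : t = t' := by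
  have hD : ∀ Zc ∈ compsD M Bk t, rD t Zc = rD t' Zc := fun Zc hZc => (restr_eq_iff.1 (h Zc hZc)).2.2
  have hP : ∀ Zc ∈ compsD M Bk t, rP M t Zc = rP M t' Zc := fun Zc hZc => (restr_eq_iff.1 (h Zc hZc)).2.1
  refine Prod.ext (Finset.Subset.antisymm (fst_subset_of_rD ht hD) (fst_subset_of_rD ht' fun Zc hZc => ?_))
    (Finset.Subset.antisymm (snd_subset_of_rP ht hP) (snd_subset_of_rP ht' fun Zc hZc => ?_))
  · rw [← hA] at hZc; exact (hD Zc hZc).symm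
  · rw [← hA] at hZc; exact (hP Zc hZc).symm

/-! ### The components of a term are admissible: non-empty, closure ⊆ Z -/

/-- A term has at least one component (Z₀ ≠ ∅); private plumbing. [folklore] -/
private theorem compsD_nonempty {L M : ℕ} {Bk Bk1 : Finset (Pt d)} {Z : Dom Bk1} {t : Finset (Dom Bk) × Finset (LBond d)}
    (ht : IsTerm L M Z t) : (compsD M Bk t).Nonempty := by
  obtain ⟨x, hx⟩ := ht.2.2.1
  exact ⟨compAt ht hx, compAt_mem ht hx⟩

/-- Z′₀ of a term = the union of the closures Z′_i of its components (as `B13Geometry236.closureDom` images) — p. 19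
*"we denote by Z′_i the smallest localization domain from 𝐃_{k+1} containing Z̃_i"*. [cite: Balaban1988RG2Cluster,
p.19 (the Z′_i)] -/
theorem biUnion_closure_compsD {L M : ℕ} (hL0 : 0 < L) {Bk Bk1 : Finset (Pt d)}
    (hB : closureIdx L (collar Bk) ⊆ Bk1) {Z : Dom Bk1} {t : Finset (Dom Bk) × Finset (LBond d)}
    (ht : IsTerm L M Z t) :
    (compsD M Bk t).biUnion (fun Zc => (closureDom hL0 hB Zc).1) = closureIdx L (collar (Z0 M t)) := by
  classical
  rw [closure_eq_biUnion_compsF]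
  ext x
  simp only [Finset.mem_biUnion, closureDom_val]
  constructor
  · rintro ⟨Zc, hZc, hx⟩
    exact ⟨Zc.1, mem_compsD.1 hZc, hx⟩
  · rintro ⟨K, hK, hx⟩
    obtain ⟨a, ha, rfl⟩ := mem_compsF.1 hK
    exact ⟨⟨compF (Z0 M t) a, isDom_compF (Z0_subset ht) ha⟩, mem_compsD.2 hK, hx⟩


/-! ## §5. From the terms to admissible sets of components: Σ_t (2.26)-weight ≤ Σ_A e^{−(κ₁−1)|Z∖A′|} Π inner -/

/-- The partial (2.26)-sum of ONE component of Z₀ — `B13Lemma3Assembly.innerSum` on the window data of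
`B13Lemma3Window` (cubes `cellsOf`, d_k = `treeLen`, bonds `touch`/`avail`): Σ_{Y₀ ⊆ Z_i} Σ_{P admissible} Σ_{𝐃
covering Y₀} omega. [cite: Balaban1988RG2Cluster, (2.26) p.17 and (2.35) p.19] -/
def inner (c : B13.Consts) (a : ℝ) (M : ℕ) (Bk : Finset (Pt d)) (Zc : Dom Bk) : ℝ :=
  innerSum (Finset.univ : Finset (Dom Bk)) (fun Y : Dom Bk => cellsOf Bk Y.1) (sys Bk).dj (cellsOf Bk Zc.1)
    (touch M Bk) (avail M Bk Zc) (c.α₆ * c.eps2) ((1 - 3 * c.δ) * c.κ) a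

/-- The component sums are non-negative; private plumbing. [folklore] -/
private theorem inner_nonneg (c : B13.Consts) (a : ℝ) (M : ℕ) (Bk : Finset (Pt d)) (hA : 0 ≤ c.α₆ * c.eps2) (Zc : Dom Bk) :
    0 ≤ inner c a M Bk Zc :=
  B13Lemma3Assembly.innerSum_nonneg _ _ _ _ _ _ hA

/-- **The right-hand side of (2.26) for a term (𝐃, P) of H(Z)** without its last factor exp O(1)α₅|Z| — (2.26) p. 17,
verbatim: *"|(2.14)| ≦ exp(−(κ₁ − 1)(LM)⁻⁴|Z∖Z′₀|)[Π_{Y∈𝐃} 2E₀ε₁C₁α₄⁻¹M^q exp C₂κ₁ exp(−(1 − 3δ)κd_k(Y))]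
exp(−½γ₂(ε₁²/g_k²)|P|) · exp O(1)α₅|Z|"*: e^{−(κ₁−1)·#LM-cubes of Z∖Z′₀} · Π_{Y∈𝐃} α₆ε₂e^{−(1−3δ)κ treeLen Y} ·
e^{−(a/2)|P|} (a = γ₂ε₁²/g_k², α₆ε₂ = the printed bracket constant), Z′₀ = `closureIdx L (collar Z₀)`. [cite:
Balaban1988RG2Cluster, (2.26) p.17] -/
def weight (c : B13.Consts) (L M : ℕ) {Bk Bk1 : Finset (Pt d)} (Z : Dom Bk1) (a : ℝ)
    (t : Finset (Dom Bk) × Finset (LBond d)) : ℝ :=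
  Real.exp (-((c.κ₁ - 1) * ((cellsOf Bk1 (Z.1 \ closureIdx L (collar (Z0 M t)))).card : ℝ))) *
    ((∏ Y ∈ t.1, (c.α₆ * c.eps2 * Real.exp (-((1 - 3 * c.δ) * c.κ * (sys Bk).dj Y)))) *
      Real.exp (-(a / 2 * (t.2.card : ℝ))))

/-- The (2.26)-weights are non-negative. [cite: Balaban1988RG2Cluster, (2.26) p.17] -/
theorem weight_nonneg (c : B13.Consts) (L M : ℕ) {Bk Bk1 : Finset (Pt d)} (Z : Dom Bk1) (a : ℝ)
    (hA : 0 ≤ c.α₆ * c.eps2) (t : Finset (Dom Bk) × Finset (LBond d)) : 0 ≤ weight c L M Z a t :=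
  mul_nonneg (Real.exp_nonneg _)
    (mul_nonneg (Finset.prod_nonneg fun _ _ => mul_nonneg hA (Real.exp_nonneg _)) (Real.exp_nonneg _))

/-- The closure-union Z′₀ = ∪_{Z_i ∈ A} Z′_i of a set A of 𝐃_k-domains (p. 19). [cite: Balaban1988RG2Cluster, p.19
(the Z′_i)] -/
def clSet {L : ℕ} (hL0 : 0 < L) {Bk Bk1 : Finset (Pt d)} (hB : closureIdx L (collar Bk) ⊆ Bk1) (A : Finset (Dom Bk)) :
    Finset (Pt d) :=
  A.biUnion fun Zc => (closureDom hL0 hB Zc).1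

open Classical in
/-- The admissible sets of components at fixed Z: non-empty, with closure-union Z′₀ ⊆ Z (p. 14 / p. 20 *"Finally we
sum over all Z′₀ ⊂ Z"*). [cite: Balaban1988RG2Cluster, (2.9) p.14 and p.17 (resummation order)] -/
def admA {L : ℕ} (hL0 : 0 < L) {Bk Bk1 : Finset (Pt d)} (hB : closureIdx L (collar Bk) ⊆ Bk1) (Z : Dom Bk1) :
    Finset (Finset (Dom Bk)) :=
  (Finset.univ : Finset (Dom Bk)).powerset.filter fun A => A.Nonempty ∧ clSet hL0 hB A ⊆ Z.1

open Classical in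
/-- Membership in `admA`; private plumbing. [folklore] -/
private theorem mem_admA {L : ℕ} {hL0 : 0 < L} {Bk Bk1 : Finset (Pt d)} {hB : closureIdx L (collar Bk) ⊆ Bk1} {Z : Dom Bk1}
    {A : Finset (Dom Bk)} : A ∈ admA hL0 hB Z ↔ A.Nonempty ∧ clSet hL0 hB A ⊆ Z.1 := by
  simp [admA]

open Classical in
/-- The components of a term form an admissible set; private plumbing. [folklore] -/
private theorem compsD_mem_admA {L M : ℕ} (hL0 : 0 < L) {Bk Bk1 : Finset (Pt d)} (hB : closureIdx L (collar Bk) ⊆ Bk1)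
    {Z : Dom Bk1} {t : Finset (Dom Bk) × Finset (LBond d)} (ht : IsTerm L M Z t) :
    compsD M Bk t ∈ admA hL0 hB Z := by
  refine mem_admA.2 ⟨compsD_nonempty ht, ?_⟩
  unfold clSet
  rw [biUnion_closure_compsD hL0 hB ht]
  exact ht.2.2.2

open Classical in
/-- **Terms ⇒ component sets** (p. 17: *"For a fixed Y₀ we sum over all 𝐃 satisfying (2.2). Next, we sum over Y₀, P
determining a fixed Z₀"*): grouping the terms by their set A of components of Z₀ and bounding, for each A, the sum of
the factorized weights by the product of the FULL component sums (injection `restr`, `sum_le_prod_sum`): Σ_{terms}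
weight ≤ Σ_{A admissible} e^{−(κ₁−1)|Z∖Z′₀(A)|} Π_{Z_i∈A} inner(Z_i) — the content of (2.26) ⇒ (2.35) at the level of
index sets. [cite: Balaban1988RG2Cluster, p.17 (resummation order) and (2.35) p.19] -/
theorem sum_terms_le {L M : ℕ} (hM : 0 < M) (hL0 : 0 < L) {Bk Bk1 : Finset (Pt d)}
    (hB : closureIdx L (collar Bk) ⊆ Bk1) (c : B13.Consts) (a : ℝ) (hA : 0 ≤ c.α₆ * c.eps2) (Z : Dom Bk1) :
    ∑ t ∈ terms L M Bk Z, weight c L M Z a t ≤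
      ∑ A ∈ admA hL0 hB Z, Real.exp (-((c.κ₁ - 1) * ((cellsOf Bk1 (Z.1 \ clSet hL0 hB A)).card : ℝ))) *
        ∏ Zc ∈ A, inner c a M Bk Zc := by
  have hmaps : ∀ t ∈ terms L M Bk Z, compsD M Bk t ∈ admA hL0 hB Z :=
    fun t ht => compsD_mem_admA hL0 hB (isTerm_of_mem_terms ht)
  rw [← Finset.sum_fiberwise_of_maps_to hmaps]
  refine Finset.sum_le_sum fun A _ => ?_
  have hfib : ∀ t ∈ (terms L M Bk Z).filter (fun t => compsD M Bk t = A), weight c L M Z a t =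
      Real.exp (-((c.κ₁ - 1) * ((cellsOf Bk1 (Z.1 \ clSet hL0 hB A)).card : ℝ))) *
        ((∏ Y ∈ t.1, (c.α₆ * c.eps2 * Real.exp (-((1 - 3 * c.δ) * c.κ * (sys Bk).dj Y)))) *
          Real.exp (-(a / 2 * (t.2.card : ℝ)))) := by
    intro t ht
    obtain ⟨ht1, rfl⟩ := Finset.mem_filter.1 ht
    unfold weight clSet
    rw [biUnion_closure_compsD hL0 hB (isTerm_of_mem_terms ht1)]
  rw [Finset.sum_congr rfl hfib, ← Finset.mul_sum]
  refine mul_le_mul_of_nonneg_left ?_ (Real.exp_nonneg _)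
  have hGL := sum_le_prod_sum ((terms L M Bk Z).filter (fun t => compsD M Bk t = A)) A (innerIdx M Bk)
    (fun _ x => omega c a x) (fun _ _ x _ => omega_nonneg c a hA x) (fun t Zc => restr M t Zc)
    (fun t ht Zc hZc => by
      obtain ⟨ht1, rfl⟩ := Finset.mem_filter.1 ht
      exact restr_mem_innerIdx hM (isTerm_of_mem_terms ht1) hZc)
    (fun t ht t' ht' h => by
      obtain ⟨ht1, hA1⟩ := Finset.mem_filter.1 ht
      obtain ⟨ht1', hA1'⟩ := Finset.mem_filter.1 ht'
      exact eq_of_restr_eq (isTerm_of_mem_terms ht1) (isTerm_of_mem_terms ht1') (hA1.trans hA1'.symm)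
        fun Zc hZc => h Zc (hA1 ▸ hZc))
    (fun t => (∏ Y ∈ t.1, (c.α₆ * c.eps2 * Real.exp (-((1 - 3 * c.δ) * c.κ * (sys Bk).dj Y)))) *
      Real.exp (-(a / 2 * (t.2.card : ℝ))))
    (fun t ht => by
      obtain ⟨ht1, hA1⟩ := Finset.mem_filter.1 ht
      rw [weight_factor (isTerm_of_mem_terms ht1) c a, hA1])
  refine hGL.trans (le_of_eq (Finset.prod_congr rfl fun Zc _ => ?_))
  unfold inner
  rw [innerSum_eq]

/-! ## §6. The component sets versus the majorant: the three printed resummation levels -/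

open Classical in
/-- For a component C of Z′₀: the non-empty sets of 𝐃_k-domains whose closures lie in C and cover it (p. 19: *"For
each Z′_i we sum over all possible components of Z₀ determining this Z′_i. Then we sum over all families of domains
Z′_i such, that ∪Z′_i = Z′₀"*). [cite: Balaban1988RG2Cluster, p.19 (the sum over Z₀ with Z′₀ fixed)] -/
def S2 {L : ℕ} (hL0 : 0 < L) {Bk Bk1 : Finset (Pt d)} (hB : closureIdx L (collar Bk) ⊆ Bk1) (C : Dom Bk1) :
    Finset (Finset (Dom Bk)) :=
  (Finset.univ.filter fun Zc : Dom Bk => (closureDom hL0 hB Zc).1 ⊆ C.1).powerset.filter fun A =>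
    A.biUnion (fun Zc => cellsOf Bk1 (closureDom hL0 hB Zc).1) = cellsOf Bk1 C.1

open Classical in
/-- **Level 2 of the resummation** (pp. 19–20, verbatim: *"For each Z′_i we sum over all possible components of Z₀
determining this Z′_i. Then we sum over all families of domains Z′_i such, that ∪Z′_i = Z′₀."*): for a component C of
Z′₀, grouping the sets A by the family F = {closures} ∈ covering families of C and splitting A into its parts with a
fixed closure Z′ ∈ F: Σ_{A ∈ S2 C} Π inner ≤ famSum_{F covers C} Π_{Z′∈F} compSum_{∅ ≠ A′ ⊆ cl⁻¹Z′} Π inner — the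
`famSum ∘ compSum` of the majorant. [cite: Balaban1988RG2Cluster, p.19–20 (the sums over Z₀ and over the families
Z′_i)] -/
theorem step2 {L M : ℕ} (hL0 : 0 < L) {Bk Bk1 : Finset (Pt d)} (hB : closureIdx L (collar Bk) ⊆ Bk1)
    (c : B13.Consts) (a : ℝ) (hA : 0 ≤ c.α₆ * c.eps2) (C : Dom Bk1) :
    ∑ A ∈ S2 hL0 hB C, ∏ Zc ∈ A, inner c a M Bk Zc ≤
      famSum (B13FamilySum.coveringFamilies (Finset.univ : Finset (Dom Bk1)) (fun Z' : Dom Bk1 => cellsOf Bk1 Z'.1)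
          (cellsOf Bk1 C.1))
        (fun Z' => compSum (Finset.univ.filter fun Zc : Dom Bk => closureDom hL0 hB Zc = Z') (inner c a M Bk)) := by
  set cl : Dom Bk → Dom Bk1 := closureDom hL0 hB with hcl
  have hmaps : ∀ A ∈ S2 hL0 hB C, A.image cl ∈ B13FamilySum.coveringFamilies (Finset.univ : Finset (Dom Bk1))
      (fun Z' : Dom Bk1 => cellsOf Bk1 Z'.1) (cellsOf Bk1 C.1) := by
    intro A hA
    obtain ⟨-, hU⟩ := Finset.mem_filter.1 hA
    rw [B13FamilySum.mem_coveringFamilies]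
    refine ⟨Finset.subset_univ _, ?_⟩
    rw [Finset.image_biUnion]
    exact hU
  unfold famSum
  rw [← Finset.sum_fiberwise_of_maps_to hmaps]
  refine Finset.sum_le_sum fun F _ => ?_
  unfold compSum
  refine sum_le_prod_sum ((S2 hL0 hB C).filter fun A => A.image cl = F) F
    (fun Z' => (Finset.univ.filter fun Zc : Dom Bk => cl Zc = Z').powerset.erase ∅)
    (fun _ A' => ∏ Zc ∈ A', inner c a M Bk Zc)
    (fun _ _ A' _ => Finset.prod_nonneg fun Zc _ => inner_nonneg c a M Bk hA Zc)
    (fun A Z' => A.filter fun Zc => cl Zc = Z') ?_ ?_ (fun A => ∏ Zc ∈ A, inner c a M Bk Zc) ?_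
  · -- the fibre of A over Z′ is a non-empty set of domains with closure Z′
    intro A hA Z' hZ'
    obtain ⟨-, hF⟩ := Finset.mem_filter.1 hA
    rw [Finset.mem_erase, Finset.mem_powerset]
    constructor
    · rw [← hF] at hZ'
      obtain ⟨Zc, hZc, rfl⟩ := Finset.mem_image.1 hZ'
      exact Finset.nonempty_iff_ne_empty.1 ⟨Zc, Finset.mem_filter.2 ⟨hZc, rfl⟩⟩
    · intro Zc hZc
      exact Finset.mem_filter.2 ⟨Finset.mem_univ _, (Finset.mem_filter.1 hZc).2⟩
  · -- injectivity
    intro A hA A' hA' h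
    obtain ⟨-, hF⟩ := Finset.mem_filter.1 hA
    obtain ⟨-, hF'⟩ := Finset.mem_filter.1 hA'
    ext Zc
    constructor
    · intro hZc
      have hZ' : cl Zc ∈ F := hF ▸ Finset.mem_image_of_mem cl hZc
      have : Zc ∈ A.filter fun W => cl W = cl Zc := Finset.mem_filter.2 ⟨hZc, rfl⟩
      rw [h _ hZ'] at this
      exact (Finset.mem_filter.1 this).1
    · intro hZc
      have hZ' : cl Zc ∈ F := hF' ▸ Finset.mem_image_of_mem cl hZc
      have : Zc ∈ A'.filter fun W => cl W = cl Zc := Finset.mem_filter.2 ⟨hZc, rfl⟩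
      rw [← h _ hZ'] at this
      exact (Finset.mem_filter.1 this).1
  · -- the product over A is the product over its fibres
    intro A hA
    obtain ⟨-, hF⟩ := Finset.mem_filter.1 hA
    rw [Finset.prod_fiberwise_of_maps_to (g := cl) fun Zc hZc => hF ▸ Finset.mem_image_of_mem cl hZc]

open Classical in
/-- For an admissible Z′₀ = j: the non-empty sets of 𝐃_k-domains with closure-union exactly j. [cite:
Balaban1988RG2Cluster, p.19 (the sum over Z₀ with Z′₀ fixed)] -/
def S1 {L : ℕ} (hL0 : 0 < L) {Bk Bk1 : Finset (Pt d)} (hB : closureIdx L (collar Bk) ⊆ Bk1) (Z : Dom Bk1)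
    (j : J Z) : Finset (Finset (Dom Bk)) :=
  (Finset.univ : Finset (Dom Bk)).powerset.filter fun A => A.Nonempty ∧ clSet hL0 hB A = j.1

/-- The closure Z′_i of a member of A is connected, hence inside ONE component of Z′₀ (p. 19: *"the set Z′₀ is a
union of connected components, which are localization domains from 𝐃_{k+1}"*); private plumbing. [folklore] -/
private theorem closure_subset_component {L : ℕ} (hL0 : 0 < L) {Bk Bk1 : Finset (Pt d)}
    (hB : closureIdx L (collar Bk) ⊆ Bk1) {Z : Dom Bk1} {j : J Z} {A : Finset (Dom Bk)}
    (hA : clSet hL0 hB A = j.1) {Zc : Dom Bk} (hZc : Zc ∈ A) :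
    ∃ i : I Z j, (closureDom hL0 hB Zc).1 ⊆ i.1 := by
  obtain ⟨x, hx⟩ := (closureDom hL0 hB Zc).2.2.1
  have hxj : x ∈ j.1 := hA ▸ Finset.mem_biUnion.2 ⟨Zc, hZc, hx⟩
  refine ⟨⟨compF j.1 x, compF_mem_compsF hxj⟩, ?_⟩
  exact subset_compF_of_mem (closureDom hL0 hB Zc).2.2.2
    (fun y hy => hA ▸ Finset.mem_biUnion.2 ⟨Zc, hZc, hy⟩) hx (mem_compF_self hxj)

/-- … and in only one; private plumbing. [folklore] -/
private theorem component_unique {Bk1 : Finset (Pt d)} {Z : Dom Bk1} {j : J Z} {i i' : I Z j} {K : Finset (Pt d)}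
    (hK : K.Nonempty) (h : K ⊆ i.1) (h' : K ⊆ i'.1) : i = i' := by
  obtain ⟨x, hx⟩ := hK
  exact Subtype.ext (eq_of_mem_compsF_of_mem i.2 i'.2 (h hx) (h' hx))

open Classical in
/-- **Level 1 of the resummation** (p. 19: *"Again the set Z′₀ is a union of connected components, which are
localization domains from 𝐃_{k+1}, and we denote by Z′₀ one of the components"*; (2.37) p. 20 is a product over the
components Z′_i of Z′₀): for fixed Z′₀ = j, splitting A along the components i of j (injection, `sum_le_prod_sum`)
and applying `step2` per component: Σ_{A ∈ S1 j} Π inner ≤ Π_{i} famSum(…)(compSum …). [cite: Balaban1988RG2Cluster,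
(2.37) p.20] -/
theorem step1 {L M : ℕ} (hL0 : 0 < L) {Bk Bk1 : Finset (Pt d)} (hB : closureIdx L (collar Bk) ⊆ Bk1)
    (c : B13.Consts) (a : ℝ) (hA : 0 ≤ c.α₆ * c.eps2) (Z : Dom Bk1) (j : J Z) :
    ∑ A ∈ S1 hL0 hB Z j, ∏ Zc ∈ A, inner c a M Bk Zc ≤
      ∏ i : I Z j, famSum (B13FamilySum.coveringFamilies (Finset.univ : Finset (Dom Bk1))
          (fun Z' : Dom Bk1 => cellsOf Bk1 Z'.1) (cc Z j i))
        (fun Z' => compSum (Finset.univ.filter fun Zc : Dom Bk => closureDom hL0 hB Zc = Z') (inner c a M Bk)) := by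
  set cl : Dom Bk → Dom Bk1 := closureDom hL0 hB with hcl
  have hGL := sum_le_prod_sum (S1 hL0 hB Z j) (Finset.univ : Finset (I Z j))
    (fun i => S2 hL0 hB ⟨i.1, isDom_I Z j i⟩) (fun _ A' => ∏ Zc ∈ A', inner c a M Bk Zc)
    (fun _ _ A' _ => Finset.prod_nonneg fun Zc _ => inner_nonneg c a M Bk hA Zc)
    (fun A i => A.filter fun Zc => (cl Zc).1 ⊆ i.1) ?_ ?_ (fun A => ∏ Zc ∈ A, inner c a M Bk Zc) ?_
  · refine hGL.trans (Finset.prod_le_prod (fun i _ => Finset.sum_nonneg fun A' _ =>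
      Finset.prod_nonneg fun Zc _ => inner_nonneg c a M Bk hA Zc) fun i _ => ?_)
    exact step2 hL0 hB c a hA ⟨i.1, isDom_I Z j i⟩
  · -- the part of A over the component i covers i
    intro A hA i _
    obtain ⟨-, -, hAj⟩ := Finset.mem_filter.1 hA
    unfold S2
    rw [Finset.mem_filter, Finset.mem_powerset]
    constructor
    · intro Zc hZc
      exact Finset.mem_filter.2 ⟨Finset.mem_univ _, (Finset.mem_filter.1 hZc).2⟩
    · ext q
      rw [Finset.mem_biUnion]
      constructor
      · rintro ⟨Zc, hZc, hq⟩
        exact mem_cellsOf.2 ((Finset.mem_filter.1 hZc).2 (mem_cellsOf.1 hq))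
      · intro hq
        have hqi : q.1 ∈ i.1 := mem_cellsOf.1 hq
        obtain ⟨a, ha, hai⟩ := mem_compsF.1 i.2
        have hqj : q.1 ∈ j.1 := by rw [← hai] at hqi; exact compF_subset _ _ hqi
        rw [← hAj] at hqj
        obtain ⟨Zc, hZc, hqZc⟩ := Finset.mem_biUnion.1 hqj
        have hsub : (cl Zc).1 ⊆ i.1 := by
          rw [← hai] at hqi ⊢
          exact subset_compF_of_mem (cl Zc).2.2.2 (fun y hy => hAj ▸ Finset.mem_biUnion.2 ⟨Zc, hZc, hy⟩) hqZc hqi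
        exact ⟨Zc, Finset.mem_filter.2 ⟨hZc, hsub⟩, mem_cellsOf.2 hqZc⟩
  · -- injectivity
    intro A hA A' hA' h
    obtain ⟨-, -, hAj⟩ := Finset.mem_filter.1 hA
    obtain ⟨-, -, hAj'⟩ := Finset.mem_filter.1 hA'
    ext Zc
    constructor
    · intro hZc
      obtain ⟨i, hi⟩ := closure_subset_component hL0 hB hAj hZc
      have : Zc ∈ A.filter fun W => (cl W).1 ⊆ i.1 := Finset.mem_filter.2 ⟨hZc, hi⟩
      rw [h i (Finset.mem_univ _)] at this
      exact (Finset.mem_filter.1 this).1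
    · intro hZc
      obtain ⟨i, hi⟩ := closure_subset_component hL0 hB hAj' hZc
      have : Zc ∈ A'.filter fun W => (cl W).1 ⊆ i.1 := Finset.mem_filter.2 ⟨hZc, hi⟩
      rw [← h i (Finset.mem_univ _)] at this
      exact (Finset.mem_filter.1 this).1
  · -- the product over A is the product over the components of its parts
    intro A hA
    obtain ⟨-, -, hAj⟩ := Finset.mem_filter.1 hA
    have hAeq : A = (Finset.univ : Finset (I Z j)).biUnion fun i => A.filter fun Zc => (cl Zc).1 ⊆ i.1 := by
      ext Zc
      rw [Finset.mem_biUnion]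
      constructor
      · intro hZc
        obtain ⟨i, hi⟩ := closure_subset_component hL0 hB hAj hZc
        exact ⟨i, Finset.mem_univ _, Finset.mem_filter.2 ⟨hZc, hi⟩⟩
      · rintro ⟨i, -, hZc⟩
        exact (Finset.mem_filter.1 hZc).1
    have hdisj : ((Finset.univ : Finset (I Z j)) : Set (I Z j)).PairwiseDisjoint
        fun i => A.filter fun Zc => (cl Zc).1 ⊆ i.1 := by
      intro i _ i' _ hne
      rw [Function.onFun, Finset.disjoint_left]
      intro Zc hZc hZc'
      exact hne (component_unique (cl Zc).2.2.1 (Finset.mem_filter.1 hZc).2 (Finset.mem_filter.1 hZc').2)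
    conv_lhs => rw [hAeq]
    rw [Finset.prod_biUnion hdisj]


open Classical in
/-- **Level 0 of the resummation** (p. 20, verbatim: *"The last sum to estimate is the sum over Z′₀, or over
Z∖Z′₀"*): grouping the admissible component sets by their closure-union Z′₀ = j ∈ `B13Lemma3Window.J Z` (the factor
e^{−(κ₁−1)|Z∖Z′₀|} is constant on the group, |Z∖Z′₀| = `wZ Z j`) and applying `step1`: Σ_{A admissible} e^{…} Π inner
≤ Σ_j e^{−(κ₁−1)|wZ j|} Π_i famSum … — the majorant of `B13Lemma3Window.bound238With_window` with `inner` for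
`innerSum`. [cite: Balaban1988RG2Cluster, p.20 (the sum over Z′₀)] -/
theorem sum_admA_le {L M : ℕ} (hL0 : 0 < L) {Bk Bk1 : Finset (Pt d)} (hB : closureIdx L (collar Bk) ⊆ Bk1)
    (c : B13.Consts) (a : ℝ) (hA : 0 ≤ c.α₆ * c.eps2) (Z : Dom Bk1) :
    ∑ A ∈ admA hL0 hB Z, Real.exp (-((c.κ₁ - 1) * ((cellsOf Bk1 (Z.1 \ clSet hL0 hB A)).card : ℝ))) *
        ∏ Zc ∈ A, inner c a M Bk Zc ≤
      ∑ j : J Z, Real.exp (-((c.κ₁ - 1) * ((wZ Z j).card : ℝ))) *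
        ∏ i : I Z j, famSum (B13FamilySum.coveringFamilies (Finset.univ : Finset (Dom Bk1))
            (fun Z' : Dom Bk1 => cellsOf Bk1 Z'.1) (cc Z j i))
          (fun Z' => compSum (Finset.univ.filter fun Zc : Dom Bk => closureDom hL0 hB Zc = Z')
            (inner c a M Bk)) := by
  -- the closure-union of an admissible set, as an admissible Z′₀
  have hne : ∀ A : Finset (Dom Bk), A.Nonempty → (clSet hL0 hB A).Nonempty := by
    intro A ⟨Zc, hZc⟩
    obtain ⟨x, hx⟩ := (closureDom hL0 hB Zc).2.2.1
    exact ⟨x, Finset.mem_biUnion.2 ⟨Zc, hZc, hx⟩⟩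
  set jOf : Finset (Dom Bk) → J Z := fun A =>
    if h : A.Nonempty ∧ clSet hL0 hB A ⊆ Z.1 then ⟨clSet hL0 hB A, h.2, hne A h.1⟩
    else ⟨Z.1, subset_rfl, Z.2.2.1⟩ with hjOf
  have hjOf_val : ∀ A ∈ admA hL0 hB Z, (jOf A).1 = clSet hL0 hB A := by
    intro A hA
    have h := mem_admA.1 hA
    simp only [hjOf, dif_pos h]
  rw [← Finset.sum_fiberwise (admA hL0 hB Z) jOf]
  refine Finset.sum_le_sum fun j _ => ?_
  have hfib : ∀ A ∈ (admA hL0 hB Z).filter (fun A => jOf A = j),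
      Real.exp (-((c.κ₁ - 1) * ((cellsOf Bk1 (Z.1 \ clSet hL0 hB A)).card : ℝ))) * ∏ Zc ∈ A, inner c a M Bk Zc =
      Real.exp (-((c.κ₁ - 1) * ((wZ Z j).card : ℝ))) * ∏ Zc ∈ A, inner c a M Bk Zc := by
    intro A hA
    obtain ⟨hA1, hAj⟩ := Finset.mem_filter.1 hA
    have : clSet hL0 hB A = j.1 := by rw [← hjOf_val A hA1, hAj]
    rw [this]
    rfl
  rw [Finset.sum_congr rfl hfib, ← Finset.mul_sum]
  refine mul_le_mul_of_nonneg_left ?_ (Real.exp_nonneg _)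
  have hsub : (admA hL0 hB Z).filter (fun A => jOf A = j) ⊆ S1 hL0 hB Z j := by
    intro A hA
    obtain ⟨hA1, hAj⟩ := Finset.mem_filter.1 hA
    unfold S1
    rw [Finset.mem_filter, Finset.mem_powerset]
    exact ⟨Finset.subset_univ _, (mem_admA.1 hA1).1, by rw [← hjOf_val A hA1, hAj]⟩
  exact (Finset.sum_le_sum_of_subset_of_nonneg hsub fun A _ _ =>
    Finset.prod_nonneg fun Zc _ => inner_nonneg c a M Bk hA Zc).trans (step1 hL0 hB c a hA Z j)

/-! ## §7. The theorems: (2.26) for every term ⇒ the majorant `hrep`; Lemma 3 (2.38) on the window model from (2.26)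
per term and numbers -/

open Classical in
/-- **The (2.26)-weights of ALL terms of H(Z), summed, are bounded by the majorant `hrep` of
`B13Lemma3Window.bound238With_window`** — the printed resummation order p. 17 (*"For a fixed Y₀ we sum over all 𝐃
satisfying (2.2). Next, we sum over Y₀, P determining a fixed Z₀. Further, for a fixed Z′₀, we sum over all possible
Z₀ determining this fixed Z′₀. Finally we sum over all Z′₀ ⊂ Z."*) realized as the injection of the term set into the
nested index sets of the majorant (`sum_terms_le`, `sum_admA_le`). [cite: Balaban1988RG2Cluster, p.17 (resummation
order)] -/
theorem sum_weight_le_majorant {L M : ℕ} (hM : 0 < M) (hL0 : 0 < L) {Bk Bk1 : Finset (Pt d)}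
    (hB : closureIdx L (collar Bk) ⊆ Bk1) (c : B13.Consts) (a : ℝ) (hA : 0 ≤ c.α₆ * c.eps2) (Z : Dom Bk1) :
    ∑ t ∈ terms L M Bk Z, weight c L M Z a t ≤
      ∑ j : J Z, Real.exp (-((c.κ₁ - 1) * ((wZ Z j).card : ℝ))) *
        ∏ i : I Z j, famSum (B13FamilySum.coveringFamilies (Finset.univ : Finset (Dom Bk1))
            (fun Z' : Dom Bk1 => cellsOf Bk1 Z'.1) (cc Z j i))
          (fun Z' => compSum (Finset.univ.filter fun Zc : Dom Bk => closureDom hL0 hB Zc = Z')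
            (fun Zc => innerSum (Finset.univ : Finset (Dom Bk)) (fun Y : Dom Bk => cellsOf Bk Y.1)
              (sys Bk).dj (cellsOf Bk Zc.1) (touch M Bk) (avail M Bk Zc)
              (c.α₆ * c.eps2) ((1 - 3 * c.δ) * c.κ) a)) :=
  (sum_terms_le hM hL0 hB c a hA Z).trans (sum_admA_le hL0 hB c a hA Z)

open Classical in
/-- **(2.26) FOR EVERY TERM ⇒ the hypothesis `hrep`** of `B13Lemma3Window.bound238With_window` /
`B13Lemma3Assembly.bound238With_of_226`: if on the space of p. 15 the activity is dominated by its terms, ‖H(Z)‖ ≤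
Σ_{t ∈ terms Z} ‖T_t‖ (e.g. H(Z) = Σ_t T_t, (2.9)/(2.14)), and every term obeys (2.26) — ‖T_t‖ ≤
weight(t)·e^{a₅·#LM-cubes of Z} (p. 17; a₅ = O(1)(LM)⁴α₅, p. 20) — then ‖H(Z)‖ ≤ e^{a₅|Z|}·(majorant). [cite:
Balaban1988RG2Cluster, (2.26) p.17] -/
theorem hrep_of_termwise {L M : ℕ} (hM : 0 < M) (hL0 : 0 < L) {Bk Bk1 : Finset (Pt d)}
    (hB : closureIdx L (collar Bk) ⊆ Bk1) (c : B13.Consts) {a a₅ : ℝ} (hA : 0 ≤ c.α₆ * c.eps2)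
    (W : B13Lemma3Window.TwoWindowStep Bk Bk1)
    (T : (Z : Dom Bk1) → Finset (Dom Bk) × Finset (LBond d) → W.Φ → ℂ)
    (hH : ∀ (Z : Dom Bk1) (φ : W.Φ), φ ∈ W.sp2 Z → ‖W.H Z φ‖ ≤ ∑ t ∈ terms L M Bk Z, ‖T Z t φ‖)
    (h226 : ∀ (Z : Dom Bk1) (φ : W.Φ), φ ∈ W.sp2 Z → ∀ t ∈ terms L M Bk Z,
      ‖T Z t φ‖ ≤ weight c L M Z a t * Real.exp (a₅ * ((cellsOf Bk1 Z.1).card : ℝ))) :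
    ∀ (Z : Dom Bk1) (φ : W.Φ), φ ∈ W.sp2 Z → ‖W.H Z φ‖ ≤
      Real.exp (a₅ * ((cellsOf Bk1 Z.1).card : ℝ)) *
      ∑ j : J Z, Real.exp (-((c.κ₁ - 1) * ((wZ Z j).card : ℝ))) *
        ∏ i : I Z j, famSum (B13FamilySum.coveringFamilies (Finset.univ : Finset (Dom Bk1))
            (fun Z' : Dom Bk1 => cellsOf Bk1 Z'.1) (cc Z j i))
          (fun Z' => compSum (Finset.univ.filter fun Zc : Dom Bk => closureDom hL0 hB Zc = Z')
            (fun Zc => innerSum (Finset.univ : Finset (Dom Bk)) (fun Y : Dom Bk => cellsOf Bk Y.1)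
              (sys Bk).dj (cellsOf Bk Zc.1) (touch M Bk) (avail M Bk Zc)
              (c.α₆ * c.eps2) ((1 - 3 * c.δ) * c.κ) a)) := by
  intro Z φ hφ
  calc ‖W.H Z φ‖ ≤ ∑ t ∈ terms L M Bk Z, ‖T Z t φ‖ := hH Z φ hφ
    _ ≤ ∑ t ∈ terms L M Bk Z, weight c L M Z a t * Real.exp (a₅ * ((cellsOf Bk1 Z.1).card : ℝ)) :=
        Finset.sum_le_sum fun t ht => h226 Z φ hφ t ht
    _ = Real.exp (a₅ * ((cellsOf Bk1 Z.1).card : ℝ)) * ∑ t ∈ terms L M Bk Z, weight c L M Z a t := by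
        rw [Finset.mul_sum]
        exact Finset.sum_congr rfl fun t _ => mul_comm _ _
    _ ≤ _ := mul_le_mul_of_nonneg_left (sum_weight_le_majorant hM hL0 hB c a hA Z) (Real.exp_nonneg _)

open Classical in
/-- **Lemma 3 (2.38) AS PRINTED on the two-scale window model, from (2.26) FOR EVERY TERM and the restrictions on the
constants only.**  Lemma 3 p. 20, verbatim: *"Under all the above restrictions on the constants M, κ, κ₁, α₀, α₁, α₄,
α₆, γ₂, γ, ε₁, the activity H(Z) for a localization domain Z ∈ 𝐃_{k+1} satisfies the inequality |H(Z)| ≦ C₃ε₁ exp(−(1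
− 8δ)½Lκd_{k+1}(Z)). (2.38)"*  For two-window step data (`B13Lemma3Window.TwoWindowStep`, d = 4, L = `c.L` ≥ 8, cube
size M ≥ 1): termwise domination `hH` + (2.26) per term `h226` + the numerical restrictions of
`B13Lemma3Window.bound238_window` ⇒ `B13.Bound238 W.toStepData c`.  What remains by assertion is exactly the analytic
content (2.15)–(2.26) of the printed proof (and the representation of H(Z) by its terms, (2.9)/(2.14)); every
resummation, geometric and combinatorial step of pp. 17–20 is a theorem. [cite: Balaban1988RG2Cluster, Lemma 3 (2.38)
p.20] -/
theorem bound238_window_of_226 (c : B13.Consts) (hL : 8 ≤ c.L) {Bk Bk1 : Finset (Pt 4)}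
    (hB : closureIdx c.L (collar Bk) ⊆ Bk1) (W : B13Lemma3Window.TwoWindowStep Bk Bk1) {M : ℕ} (hM : 0 < M)
    (T : (Z : Dom Bk1) → Finset (Dom Bk) × Finset (LBond 4) → W.Φ → ℂ) {a a₂ a₂' a₅ Aabs : ℝ}
    (hH : ∀ (Z : Dom Bk1) (φ : W.Φ), φ ∈ W.sp2 Z → ‖W.H Z φ‖ ≤ ∑ t ∈ terms c.L M Bk Z, ‖T Z t φ‖)
    (h226 : ∀ (Z : Dom Bk1) (φ : W.Φ), φ ∈ W.sp2 Z → ∀ t ∈ terms c.L M Bk Z,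
      ‖T Z t φ‖ ≤ weight c c.L M Z a t * Real.exp (a₅ * ((cellsOf Bk1 Z.1).card : ℝ)))
    (hα₆ : 0 < c.α₆) (hε₀ : 0 ≤ c.eps2) (hδ : 0 ≤ c.δ) (hδ7 : 0 ≤ 1 - 7 * c.δ) (hκ : 0 ≤ c.κ) (ha : 0 ≤ a)
    (hR15 : c.R15) (hR16 : 17 * ((1 - 4 * c.δ) * c.κ) ≤ a / 20) (hR16' : 4 * c.κ ≤ a / 20)
    (hR17 : Real.exp (-(a / 20)) ≤ c.eps2) (h231 : 2 * (4 : ℝ) * (M : ℝ) ^ 4 * Real.exp (-(a / 10)) ≤ a / 20)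
    (ha₂ : 0 ≤ a₂) (hκ229 : kappa₀ 64 8 + a₂ ≤ c.δ * c.κ)
    (hsm229 : c.α₆ * Real.exp a₂ * K₀ 64 8 * 64 ≤ a₂)
    (habsk : Real.exp (-(a / 20)) * 64 ≤ c.δ * c.κ)
    (h18half : B13Step237.R18half c (K₀ 64 8 * Real.exp (Real.exp (-(a / 20)) * 64)))
    (h18 : B13Step237.R18sharp c (K₀ 64 8 * Real.exp (Real.exp (-(a / 20)) * 64)) ((c.L : ℝ) / 2))
    (ha₂' : 0 ≤ a₂') (hκ229' : kappa₀ 64 8 + a₂' ≤ c.δ * ((c.L : ℝ) / 2) * c.κ)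
    (hsm229' : c.α₆ * Real.exp a₂' * K₀ 64 8 * 64 ≤ a₂')
    (hR20 : 17 * ((1 - 7 * c.δ) * ((c.L : ℝ) / 2) * c.κ) ≤ (c.κ₁ - 1) / 2)
    (ha₅ : 0 ≤ a₅) (habs : a₅ + Real.exp (-((c.κ₁ - 1) / 2)) ≤ Aabs)
    (hAc : Aabs * 64 ≤ c.δ * ((c.L : ℝ) / 2) * c.κ)
    (hC3 : B13Step237.bracketF c (K₀ 64 8 * Real.exp (Real.exp (-(a / 20)) * 64)) / c.α₆ *
      Real.exp (Aabs * 64) ≤ c.C3act * c.ε₁) :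
    B13.Bound238 W.toStepData c :=
  B13Lemma3Window.bound238_window c hL hB W M
    (hrep_of_termwise hM (by omega) hB c (mul_nonneg hα₆.le hε₀) W T hH h226)
    hα₆ hε₀ hδ hδ7 hκ ha hR15 hR16 hR16' hR17 h231 ha₂ hκ229 hsm229 habsk h18half h18 ha₂' hκ229' hsm229' hR20 ha₅
    habs hAc hC3

end

end Literature.MathematicalPhysics.QuantumFieldTheory.Balaban1983to89.B13Lemma3WindowTerms
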